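import Summits.CriticalPhenomena.PercolationContinuityZ3.Theorems.PercNearOneGluingNoHeavyLowerTailSunflowerMultiPetalKempeMarkedUnpairedTI
import Summits.CriticalPhenomena.PercolationContinuityZ3.Theorems.PercNearOneGluingNoHeavyLowerTailSunflowerMultiPetalKempeMarkedUnpairedBoth
import HarnessLib
import HarnessLib.Audit

/-!
# `NoHeavyLowerTail` (crux stmt-CriticalPhenomena-4575), marked-multigraph layer: THEOREM U′ row by row and for the fractional-mark functional `TI_{P,Q}`

Support file (seat `prim-l12-p2` gen 54; `--supports stmt-CriticalPhenomena-4575`; sequel of `…KempeMarkedUnpairedBoth` and `…KempeMarkedUnpairedTI`).  No `sorry`; nothing is asserted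
about the crux.  Memo: run/shared/lean/prim/prim-l12/prim-l12-p2/FINDING-g54-UNPAIRED-ALL-D-LAW.md §2–§3.

THEOREM U′ (`TfunM_step_unpaired_both`: `T(K) ≥ T(K') + ½T(K'/(S∪u)) + ½T(K'/(S∪v))` at an unmarked `y` adjacent to both terminals, `|S| ≥ 1`) is CELLWISE, so it holds for every
filtered functional `T_Φ` and hence for `TIw = 2^{|P|+|Q|}·TI_{P,Q}` with far special sets:
* `allOneSumF`, `sum_resB2_filter_eq`, `TfunF_peelContract_right`, **`TfunF_step_unpaired_both`** (U′ for every `Φ` ignoring the colours on `S ∪ {y}`);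
* **`TIw_step_unpaired_both`**: `2·3^{|S|}·TIw(K.isolate y) + TIw(K.peelContract y S u) + TIw(K.peelContract y S v) ≤ 2·3^{|S|+1}·TIw(K)` for all `P, Q` avoiding `S ∪ {y}`.
With `TIw_step_unpaired` (THEOREM U) this kernel-checks the TI step at every unmarked non-special `y ∼ u` of outer degree `≥ 2` whose neighbours are non-special
(memo §3; the `y ∼ v` cases follow by the terminal symmetry, the degrees `0, 1` are finite tables).
-/

namespace Summit.CriticalPhenomena.PercolationContinuityZ3.Theorems.SunflowerPartition.Kempe

open Finset

namespace MGraph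

variable {V : Type*} [Fintype V] [LinearOrder V] (K : MGraph V)

section BothFilter

variable (Φ : (V → Fin 3) → Prop) [DecidablePred Φ]

/-- Filtered all-`1` kernel sum. [this work] -/
def allOneSumF (y : V) (S : Finset V) (u v : V) : ℤ :=
  ∑ ρ ∈ univ.filter (fun ρ : V → Fin 3 => (ρ u = 0 ∧ ρ v = 1) ∧ Φ ρ), (if ∀ s ∈ S, ρ s = 1 then fC ((K.isolate y).ctypeM ρ) else 0)

/-- **Filtered cell identity of U′**: `Σ_{Φ-cells} resB2 = 2·(3·T_Φ(K) − T_Φ(K.isolate y)) − allZeroSumF − allOneSumF`. [this work] -/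
theorem sum_resB2_filter_eq (y : V) (S : Finset V) (u v : V) (huy : u ≠ y) (hvy : v ≠ y) (hΦ : ∀ σ c, Φ (Function.update σ y c) ↔ Φ σ) :
    ∑ ρ ∈ univ.filter (fun ρ : V → Fin 3 => (ρ u = 0 ∧ ρ v = 1) ∧ Φ ρ), K.resB2 y S ρ
      = 2 * (3 * K.TfunF Φ u v - (K.isolate y).TfunF Φ u v) - K.allZeroSumF Φ y S u v - K.allOneSumF Φ y S u v := by
  have h := K.sum_kerTAbs_filter Φ y u v huy hvy hΦ
  unfold resB2 allZeroSumF allOneSumF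
  rw [sum_sub_distrib, sum_sub_distrib, ← mul_sum, h]

/-- `T_Φ(K.peelContract y S v) = 3^{|S|}·allOneSumF` for `Φ` ignoring the colours on `S`. [this work] -/
theorem TfunF_peelContract_right (y u v : V) (S : Finset V) (hvy : v ≠ y) (huS : u ∉ S) (hvS : v ∉ S) (hyS : y ∉ S)
    (hΦS : ∀ s ∈ S, ∀ σ c, Φ (Function.update σ s c) ↔ Φ σ) :
    (K.peelContract y S v).TfunF Φ u v = 3 ^ S.card * K.allOneSumF Φ y S u v := by
  set L := K.peelContract y S v with hL
  have hZ : ∀ z ∈ S, L.IsFree z := fun z hz => K.isFree_peelContract_of_mem y v S hz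
  have h2 := L.sum_filter_eq_pow_mul fC S hZ (fun σ => (σ u = 0 ∧ σ v = 1) ∧ Φ σ)
    (fun z hz σ c => by
      have hzu : z ≠ u := fun e => huS (e ▸ hz)
      have hzv : z ≠ v := fun e => hvS (e ▸ hz)
      rw [Function.update_of_ne hzu.symm, Function.update_of_ne hzv.symm, hΦS z hz σ c])
    (fun _ _ => 1) (fun _ _ _ _ _ _ => rfl)
  have h3 : ∑ σ ∈ univ.filter (fun σ : V → Fin 3 => ((σ u = 0 ∧ σ v = 1) ∧ Φ σ) ∧ ∀ z ∈ S, σ z = (1 : Fin 3)), fC (L.ctypeM σ)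
      = ∑ σ ∈ univ.filter (fun σ : V → Fin 3 => ((σ u = 0 ∧ σ v = 1) ∧ Φ σ) ∧ ∀ z ∈ S, σ z = (1 : Fin 3)), fC ((K.isolate y).ctypeM σ) := by
    refine sum_congr rfl fun σ hσ => ?_
    obtain ⟨⟨⟨-, hv⟩, -⟩, hz⟩ := (mem_filter.1 hσ).2
    rw [hL, K.ctypeM_peelContract_of_const y v S hvy hvS hyS σ (fun z hz' => by rw [hz z hz', hv])]
  have h4 : ∑ σ ∈ univ.filter (fun σ : V → Fin 3 => ((σ u = 0 ∧ σ v = 1) ∧ Φ σ) ∧ ∀ z ∈ S, σ z = (1 : Fin 3)), fC ((K.isolate y).ctypeM σ)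
      = K.allOneSumF Φ y S u v := by
    unfold allOneSumF
    rw [sum_filter, sum_filter]
    refine sum_congr rfl fun σ _ => ?_
    by_cases hP : (σ u = 0 ∧ σ v = 1) ∧ Φ σ
    · by_cases hQ : ∀ z ∈ S, σ z = 1
      · rw [if_pos ⟨hP, hQ⟩, if_pos hP, if_pos hQ]
      · rw [if_neg (fun h => hQ h.2), if_pos hP, if_neg hQ]
    · rw [if_neg (fun h => hP h.1), if_neg hP]
  unfold TfunF
  rw [h2, h3, h4]

variable {K}
variable {u v y : V} {S : Finset V}

/-- **THEOREM U′ ROW BY ROW**: for every `Φ` ignoring the colours on `S ∪ {y}` (`y` unmarked, `mul y u ≠ 0`, `mul y v ≠ 0`, `S ≠ ∅`),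
`2·3^{|S|}·T_Φ(K.isolate y) + T_Φ(K.peelContract y S u) + T_Φ(K.peelContract y S v) ≤ 2·3^{|S|+1}·T_Φ(K)`. [this work] -/
theorem TfunF_step_unpaired_both (huv : u ≠ v) (hyu : y ≠ u) (hyv : y ≠ v) (hmark : K.mark y = 0) (hadj : K.mul y u ≠ 0) (hadj' : K.mul y v ≠ 0)
    (hS : ∀ w, w ∈ S ↔ (w ≠ u ∧ w ≠ v ∧ w ≠ y ∧ K.mul y w ≠ 0)) (hne : S.Nonempty)
    (hΦ : ∀ z, (z = y ∨ z ∈ S) → ∀ σ c, Φ (Function.update σ z c) ↔ Φ σ) :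
    2 * 3 ^ S.card * (K.isolate y).TfunF Φ u v + (K.peelContract y S u).TfunF Φ u v + (K.peelContract y S v).TfunF Φ u v
      ≤ 2 * 3 ^ (S.card + 1) * K.TfunF Φ u v := by
  have huS : u ∉ S := fun h => ((hS u).1 h).1 rfl
  have hvS : v ∉ S := fun h => ((hS v).1 h).2.1 rfl
  have hyS : y ∉ S := fun h => ((hS y).1 h).2.2.1 rfl
  have hΦy : ∀ σ c, Φ (Function.update σ y c) ↔ Φ σ := hΦ y (Or.inl rfl)
  have hΦS : ∀ s ∈ S, ∀ σ c, Φ (Function.update σ s c) ↔ Φ σ := fun s hs => hΦ s (Or.inr hs)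
  have h1 := K.sum_resB2_filter_eq Φ y S u v hyu.symm hyv.symm hΦy
  have h2 : 0 ≤ ∑ ρ ∈ univ.filter (fun ρ : V → Fin 3 => (ρ u = 0 ∧ ρ v = 1) ∧ Φ ρ), K.resB2 y S ρ :=
    sum_nonneg fun ρ hρ => by
      have h := ((mem_filter.1 hρ).2).1
      exact resB2_nonneg hS huv hyu hyv hmark hadj hadj' hne ρ h.1 h.2
  rw [h1] at h2
  have hA := K.TfunF_peelContract Φ y u v S hyu.symm huS hvS hyS hΦS
  have hB := K.TfunF_peelContract_right Φ y u v S hyv.symm huS hvS hyS hΦS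
  rw [hA, hB, pow_succ]
  have hp : (0 : ℤ) ≤ 3 ^ S.card := by positivity
  have key : 2 * (K.isolate y).TfunF Φ u v + K.allZeroSumF Φ y S u v + K.allOneSumF Φ y S u v ≤ 6 * K.TfunF Φ u v := by linarith
  nlinarith [mul_le_mul_of_nonneg_left key hp]

end BothFilter

section BothTI

/-- **THEOREM U′ FOR `TI_{P,Q}`** (memo §2–§3): for `u ≠ v`, an unmarked `y` with `mul y u ≠ 0`, `mul y v ≠ 0`, `S = N(y) ∖ {u,v} ≠ ∅` and special sets `P, Q` avoiding `S ∪ {y}`,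
`2·3^{|S|}·TIw(K.isolate y) + TIw(K.peelContract y S u) + TIw(K.peelContract y S v) ≤ 2·3^{|S|+1}·TIw(K)`. [this work] -/
theorem TIw_step_unpaired_both (u v y : V) (huv : u ≠ v) (hyu : y ≠ u) (hyv : y ≠ v) (hmark : K.mark y = 0) (hadj : K.mul y u ≠ 0) (hadj' : K.mul y v ≠ 0)
    (S : Finset V) (hS : ∀ w, w ∈ S ↔ (w ≠ u ∧ w ≠ v ∧ w ≠ y ∧ K.mul y w ≠ 0)) (hne : S.Nonempty)
    (P Q : Finset V) (hP : ∀ z, (z = y ∨ z ∈ S) → z ∉ P) (hQ : ∀ z, (z = y ∨ z ∈ S) → z ∉ Q) :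
    2 * 3 ^ S.card * (K.isolate y).TIw P Q u v + (K.peelContract y S u).TIw P Q u v + (K.peelContract y S v).TIw P Q u v
      ≤ 2 * 3 ^ (S.card + 1) * K.TIw P Q u v := by
  have huS : u ∉ S := fun h => ((hS u).1 h).1 rfl
  have hvS : v ∉ S := fun h => ((hS v).1 h).2.1 rfl
  set t := (range (P.card + 1)) ×ˢ (range (Q.card + 1)) with ht
  let Φ : ℕ × ℕ → (V → Fin 3) → Prop := fun p σ => iCount P σ = p.1 ∧ jCount Q σ = p.2
  let wt : ℕ × ℕ → ℤ := fun p => 2 ^ (P.card - p.1) * 2 ^ (Q.card - p.2)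
  let Kp : ℕ × ℕ → MGraph V := fun p => (K.addMark u p.1).addMark v p.2
  have hwt : ∀ p, 0 ≤ wt p := fun p => by positivity
  have hΦ : ∀ p z, (z = y ∨ z ∈ S) → ∀ σ c, Φ p (Function.update σ z c) ↔ Φ p σ := fun p z hz σ c => by
    simp only [Φ, iCount_update P σ (hP z hz) c, jCount_update Q σ (hQ z hz) c]
  have hE : ∀ p ∈ t,
      wt p * (2 * 3 ^ S.card * ((Kp p).isolate y).TfunF (Φ p) u v + ((Kp p).peelContract y S u).TfunF (Φ p) u v
        + ((Kp p).peelContract y S v).TfunF (Φ p) u v)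
      ≤ wt p * (2 * 3 ^ (S.card + 1) * (Kp p).TfunF (Φ p) u v) := by
    intro p _
    refine mul_le_mul_of_nonneg_left ?_ (hwt p)
    have hmark' : (Kp p).mark y = 0 := by
      simp only [Kp, mark_addMark, if_neg hyv, if_neg hyu, add_zero, hmark]
    have hadj1 : (Kp p).mul y u ≠ 0 := by simpa only [Kp, mul_addMark] using hadj
    have hadj2 : (Kp p).mul y v ≠ 0 := by simpa only [Kp, mul_addMark] using hadj'
    have hS' : ∀ z, z ∈ S ↔ (z ≠ u ∧ z ≠ v ∧ z ≠ y ∧ (Kp p).mul y z ≠ 0) := fun z => by simpa only [Kp, mul_addMark] using hS z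
    exact TfunF_step_unpaired_both (Φ p) huv hyu hyv hmark' hadj1 hadj2 hS' hne (hΦ p)
  have hsum := sum_le_sum hE
  have e1 : ∀ p, (Kp p).isolate y = ((K.isolate y).addMark u p.1).addMark v p.2 := fun p => by
    simp only [Kp, isolate_addMark _ v y hyv.symm, isolate_addMark _ u y hyu.symm]
  have e2 : ∀ p, (Kp p).peelContract y S u = ((K.peelContract y S u).addMark u p.1).addMark v p.2 := fun p => by
    simp only [Kp, peelContract_addMark _ v y u S _ hyv.symm hvS, peelContract_addMark _ u y u S _ hyu.symm huS]
  have e3 : ∀ p, (Kp p).peelContract y S v = ((K.peelContract y S v).addMark u p.1).addMark v p.2 := fun p => by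
    simp only [Kp, peelContract_addMark _ v y v S _ hyv.symm hvS, peelContract_addMark _ u y v S _ hyu.symm huS]
  rw [K.TIw_eq_sum_classes P Q u v, (K.isolate y).TIw_eq_sum_classes P Q u v, (K.peelContract y S u).TIw_eq_sum_classes P Q u v,
    (K.peelContract y S v).TIw_eq_sum_classes P Q u v]
  rw [← ht, mul_sum, mul_sum, ← sum_add_distrib, ← sum_add_distrib]
  refine le_trans (le_of_eq ?_) (le_trans hsum (le_of_eq ?_))
  · refine sum_congr rfl fun p _ => ?_
    rw [e1 p, e2 p, e3 p]
    simp only [wt, Φ]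
    ring
  · refine sum_congr rfl fun p _ => ?_
    simp only [Kp, wt, Φ]
    ring

end BothTI

end MGraph

end Summit.CriticalPhenomena.PercolationContinuityZ3.Theorems.SunflowerPartition.Kempe
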